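import Summits.Ventures.AbcSig.Rows.Bridge
import Summits.Ventures.AbcSig.Rows.C2aL317A0S
import Summits.Ventures.AbcSig.Rows.C2aL317A0SAB

/-!
# Venture AbcSig — CELL `C2aL317A0`: the census statement `Rows.C2aCellRed 317 (fun a => a = 0) {37}` from the two row theorems

S-VARIANT (p-lean g6 `gen6/spatch.py`) of `xcell_C2aL317A0`: kernel sieve discharges replace the cited pair(s) 10144.8 @ 13 (see the row files `Rows/C2aL317A0S.lean`, `Rows/C2aL317A0SAB.lean`).
HONEST FRAMING. COMPUTATION cell `pub-abcsig`; CONDITIONAL theorem; no claim on ABC or any summit. Hypotheses exactly as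
in `Rows/C2aL317A0X.lean` and `Rows/C2aL317A0XAB.lean`: `BS04Package` (CITED), `DataComplete …` (COMPUTED level files), `EisPackage` (CITED) and `Refines` (COMPUTED) for the M6 orbits discharged in the kernel, and the
rows' per-orbit exclusions for `famB` as universally quantified hypotheses (CITED: the census
row's certificates). Conclusion = p1's census predicate (`Rows/Statements.lean`), all four coprime coefficient
distributions `A·B = 2^a·317^m`, reduced exponents `a < n`, `m < n` (RULING H1). GENERATED by p-lean gen/make_rows.py
(after plean/make_cell_bridges.py).
-/

namespace Summit.Ventures.AbcSig

/-- Cell `C2aL317A0` (M6 orbits discharged in the kernel): `Rows.C2aCellRed 317 (fun a => a = 0) {37}` under the rows' hypotheses. -/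
theorem xcell_C2aL317A0S (M : NewformModel) (hP : M.BS04Package)
    (hE : M.EisPackage)
    (hD634 : M.DataComplete 634 level634Orbits)
    (hD10144 : M.DataComplete 10144 level10144Orbits)
    (hR_orbit_634_4 : M.Refines 634 orbit_634_4 m6X_634_4)
    (hX_orbit_10144_7 : ∀ n m : ℕ, n ∈ ([17] : List ℕ) → M.Excludes 10144 orbit_10144_7 (famB (2 ^ 0 * 317 ^ m) n (fun _ _ => True)))
    (hRB_orbit_10144_8 : ∀ f : M.Form 10144, M.Matches f orbit_10144_8 → M.Matches f rb_10144_8) :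
    Rows.C2aCellRed 317 (fun a => a = 0) {37} :=
  C2aCellRed_of_rows 317 (by norm_num) (by norm_num) _ _
    (fun n hn h11 hnℓ hR a m (ha : a = 0) han hm hmn x y z h1 h2 => by
      subst ha
      exact
 xrow_C2aL317A0S M hP hE hD634 hD10144 hR_orbit_634_4 n hn h11 hnℓ (by simpa using hR) m hm hmn (hX_orbit_10144_7 n m) hRB_orbit_10144_8 x y z h1 h2)
    (fun n hn h11 hnℓ hR a m (ha : a = 0) han hm hmn x y z h1 h2 => by
      subst ha
      exact
 xrow_C2aL317A0SAB M hP hE hD634 hD10144 hR_orbit_634_4 n hn h11 hnℓ (by simpa using hR) m hm hmn (hX_orbit_10144_7 n m) hRB_orbit_10144_8 x y z h1 h2)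

end Summit.Ventures.AbcSig
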